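import Mathlib
import HarnessLib
import Summits.ValiantsHypothesis.ValiantsHypothesis.Theorems.LacunarySymmetroidMatrixDescartesProductPlusOneRiccati

/-!
# ValiantsHypothesis / LacunarySymmetroid — crux `MatrixDescartes` (stmt-ValiantsHypothesis-18050, V1),
# LINE (A) «product_plus_one», floor `OneChangeFloorK3`, UPPER-SIGNED sub-cell: the AB-REDUCTION (letter-partial sums) in kernel

val-idea-25 g3's AB memo (`pub/ideators/val-idea-25/NOTE-idea25g3-18050-LINEA-AB-reduction.md`, 2026-08-28 23:04Z), items AB0–AB3.
Setting: K = 3, support `(d₀, d₀+p, d₀+q)` with `0 < p < q`, BOTTOM coupling, rows `f_j = a_{j0} x^{d₀} + a_{j1} x^{d₀+p} + a_{j2} x^{d₀+q}`,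
reduced rows `g_j(x) = a_{j0} + a_{j1} x^p + a_{j2} x^q`, UPPER-SIGNED company: `a_{j1}·a_{j2} ≥ 0` for every row (the bottom letter free) — the
T1 ∪ T5 ∪ binomial companies at EVERY ratio, i.e. the half of the floor's open core with no chart (p7 g15 memo §2/§7).

* (AB0) `eulerSum_eq_letterSums` — off the poles, the total Euler ratio is `Σ_j Φ_j(x) = p·x^p·A₁(x) + q·x^q·A₂(x)` with the LETTER-PARTIAL
  SUMS `A_l(x) = Σ_j a_{jl}/g_j(x)`;
* (AB1) `hasDerivAt_letterTerm`, `antitoneOn_letterSum` — for upper-signed rows BOTH `A₁` and `A₂` are antitone on every pole-free interval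
  (termwise `(a_l/g)′ = −a_l g′/g²` and `x·a_l·g′ = p a_1 a_l x^p + q a_2 a_l x^q ≥ 0`; no ratio condition);
* (AB2) `letterSums_opposite_of_euler_zero` — at a zero of the c-free Euler numerator `R` inside a pole-free interval, `A₁·A₂ < 0` or
  `A₁ = A₂ = 0`;
* (AB3) ★ `eulerNumerator_roots_Icc_le_one_of_letterSum_one_pos` / `…_of_letterSum_two_neg` — if `A₁ > 0` on the pole-free interval
  `[u, v] ⊂ (0,∞)`, or if `A₂ < 0` on it, then `R` has AT MOST ONE zero in `[u, v]` (`p x^{−(q−p)} A₁ + q A₂`, resp. `p A₁ + q x^{q−p} A₂`, is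
  strictly antitone).  So every extra zero of the upper-signed floor sits in a window where `A₁ < 0` somewhere and `A₂ > 0` somewhere («type α»);
  there the count is the research piece (AB4-weak `V_I ≤ C′(1 + n_I)`; AB4-strong `V_I ≤ 1` is FALSE — p5 g14 certificate, 5 zeros in one window).

HONEST FRAMING: located helper lemmas; NOT `OneChangeFloorK3`, not `stub_classRowK3`, not `stub_polyLaw`, not `MatrixDescartes`, not Conjecture B;
`VP ≠ VNP` is NOT proved.  No definitions, no named facts.
-/

set_option linter.dupNamespace false

namespace Summit.ValiantsHypothesis.ValiantsHypothesis.Theorems.LacunarySymmetroidMatrixDescartes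

namespace ProductPlusOne

open Polynomial Finset
open scoped BigOperators

/-! ### AB0 — the Euler sum through the letter-partial sums -/

/-- One row: `Φ = (p a₁ x^{d₀+p} + q a₂ x^{d₀+q})/(a₀ x^{d₀} + a₁ x^{d₀+p} + a₂ x^{d₀+q}) = p x^p·(a₁/g) + q x^q·(a₂/g)`, `g = a₀ + a₁ x^p + a₂ x^q`,
for `x > 0`. [folklore] -/
theorem eulerRatio_eq_letterTerms (a₀ a₁ a₂ : ℝ) (d0 p q : ℕ) {x : ℝ} (hx : 0 < x) (hg : a₀ + a₁ * x ^ p + a₂ * x ^ q ≠ 0) :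
    ((p : ℝ) * a₁ * x ^ (d0 + p) + (q : ℝ) * a₂ * x ^ (d0 + q)) / (a₀ * x ^ d0 + a₁ * x ^ (d0 + p) + a₂ * x ^ (d0 + q))
      = (p : ℝ) * x ^ p * (a₁ / (a₀ + a₁ * x ^ p + a₂ * x ^ q)) + (q : ℝ) * x ^ q * (a₂ / (a₀ + a₁ * x ^ p + a₂ * x ^ q)) := by
  have hx0 : x ^ d0 ≠ 0 := pow_ne_zero _ hx.ne'
  have hF : a₀ * x ^ d0 + a₁ * x ^ (d0 + p) + a₂ * x ^ (d0 + q) = x ^ d0 * (a₀ + a₁ * x ^ p + a₂ * x ^ q) := by ring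
  rw [hF]
  field_simp
  ring

/-- **(AB0)** Off the poles, `Σ_j Φ_j(x) = p x^p·A₁(x) + q x^q·A₂(x)` with `A_l = Σ_j a_{jl}/g_j`. [folklore] -/
theorem eulerSum_eq_letterSums {m : ℕ} (d0 p q : ℕ) (a : Fin m → Fin 3 → ℝ) {x : ℝ} (hx : 0 < x)
    (hg : ∀ j, a j 0 + a j 1 * x ^ p + a j 2 * x ^ q ≠ 0) :
    (∑ j, ((p : ℝ) * a j 1 * x ^ (d0 + p) + (q : ℝ) * a j 2 * x ^ (d0 + q)) / (a j 0 * x ^ d0 + a j 1 * x ^ (d0 + p) + a j 2 * x ^ (d0 + q)))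
      = (p : ℝ) * x ^ p * (∑ j, a j 1 / (a j 0 + a j 1 * x ^ p + a j 2 * x ^ q))
        + (q : ℝ) * x ^ q * (∑ j, a j 2 / (a j 0 + a j 1 * x ^ p + a j 2 * x ^ q)) := by
  rw [Finset.mul_sum, Finset.mul_sum, ← Finset.sum_add_distrib]
  exact Finset.sum_congr rfl fun j _ => eulerRatio_eq_letterTerms (a j 0) (a j 1) (a j 2) d0 p q hx (hg j)

/-! ### AB1 — the letter-partial sums are antitone for upper-signed rows -/

/-- Derivative of one letter term `a_l/(a₀ + a₁ x^p + a₂ x^q)`. [folklore] -/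
theorem hasDerivAt_letterTerm (a₀ a₁ a₂ c : ℝ) (p q : ℕ) {x : ℝ} (hg : a₀ + a₁ * x ^ p + a₂ * x ^ q ≠ 0) :
    HasDerivAt (fun y => c / (a₀ + a₁ * y ^ p + a₂ * y ^ q))
      (-(c * (a₁ * ((p : ℝ) * x ^ (p - 1)) + a₂ * ((q : ℝ) * x ^ (q - 1)))) / (a₀ + a₁ * x ^ p + a₂ * x ^ q) ^ 2) x := by
  have hg' : HasDerivAt (fun y => a₀ + a₁ * y ^ p + a₂ * y ^ q) (a₁ * ((p : ℝ) * x ^ (p - 1)) + a₂ * ((q : ℝ) * x ^ (q - 1))) x := by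
    have h1 := ((hasDerivAt_pow p x).const_mul a₁).const_add a₀
    have h2 := (hasDerivAt_pow q x).const_mul a₂
    exact h1.add h2
  have h : HasDerivAt (fun y => c * (a₀ + a₁ * y ^ p + a₂ * y ^ q)⁻¹)
      (c * (-(a₁ * ((p : ℝ) * x ^ (p - 1)) + a₂ * ((q : ℝ) * x ^ (q - 1))) / (a₀ + a₁ * x ^ p + a₂ * x ^ q) ^ 2)) x :=
    (hg'.inv hg).const_mul c
  have hfun : (fun y => c / (a₀ + a₁ * y ^ p + a₂ * y ^ q)) = fun y => c * (a₀ + a₁ * y ^ p + a₂ * y ^ q)⁻¹ := by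
    funext y; rw [div_eq_mul_inv]
  rw [hfun]
  refine h.congr_deriv ?_
  ring

/-- For an upper-signed row (`a₁ a₂ ≥ 0`) and `l ∈ {1,2}`: the numerator `a_l·(a₁ p x^{p−1} + a₂ q x^{q−1}) ≥ 0` at `x > 0`. [folklore] -/
theorem letterTerm_numerator_nonneg (a₁ a₂ : ℝ) (p q : ℕ) {x : ℝ} (hx : 0 < x) (hus : 0 ≤ a₁ * a₂) :
    0 ≤ a₁ * (a₁ * ((p : ℝ) * x ^ (p - 1)) + a₂ * ((q : ℝ) * x ^ (q - 1))) ∧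
    0 ≤ a₂ * (a₁ * ((p : ℝ) * x ^ (p - 1)) + a₂ * ((q : ℝ) * x ^ (q - 1))) := by
  have h1 : 0 ≤ (p : ℝ) * x ^ (p - 1) := mul_nonneg (Nat.cast_nonneg _) (pow_nonneg hx.le _)
  have h2 : 0 ≤ (q : ℝ) * x ^ (q - 1) := mul_nonneg (Nat.cast_nonneg _) (pow_nonneg hx.le _)
  constructor
  · have : a₁ * (a₁ * ((p : ℝ) * x ^ (p - 1)) + a₂ * ((q : ℝ) * x ^ (q - 1)))
        = a₁ * a₁ * ((p : ℝ) * x ^ (p - 1)) + a₁ * a₂ * ((q : ℝ) * x ^ (q - 1)) := by ring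
    rw [this]
    exact add_nonneg (mul_nonneg (mul_self_nonneg _) h1) (mul_nonneg hus h2)
  · have : a₂ * (a₁ * ((p : ℝ) * x ^ (p - 1)) + a₂ * ((q : ℝ) * x ^ (q - 1)))
        = a₁ * a₂ * ((p : ℝ) * x ^ (p - 1)) + a₂ * a₂ * ((q : ℝ) * x ^ (q - 1)) := by ring
    rw [this]
    exact add_nonneg (mul_nonneg hus h1) (mul_nonneg (mul_self_nonneg _) h2)

/-- One letter term of an upper-signed row is antitone on a pole-free interval `[u,v] ⊂ (0,∞)` (`c ∈ {a₁, a₂}` encoded as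
`0 ≤ c·(a₁ p x^{p−1} + a₂ q x^{q−1})`). [folklore] -/
theorem antitoneOn_letterTerm (a₀ a₁ a₂ c : ℝ) (p q : ℕ) {u v : ℝ}
    (hg : ∀ x ∈ Set.Icc u v, a₀ + a₁ * x ^ p + a₂ * x ^ q ≠ 0)
    (hnum : ∀ x ∈ Set.Icc u v, 0 ≤ c * (a₁ * ((p : ℝ) * x ^ (p - 1)) + a₂ * ((q : ℝ) * x ^ (q - 1)))) :
    AntitoneOn (fun y => c / (a₀ + a₁ * y ^ p + a₂ * y ^ q)) (Set.Icc u v) := by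
  have hderiv : ∀ x ∈ Set.Icc u v, HasDerivAt (fun y => c / (a₀ + a₁ * y ^ p + a₂ * y ^ q))
      (-(c * (a₁ * ((p : ℝ) * x ^ (p - 1)) + a₂ * ((q : ℝ) * x ^ (q - 1)))) / (a₀ + a₁ * x ^ p + a₂ * x ^ q) ^ 2) x :=
    fun x hx => hasDerivAt_letterTerm a₀ a₁ a₂ c p q (hg x hx)
  refine antitoneOn_of_deriv_nonpos (convex_Icc u v) ?_ ?_ ?_
  · exact fun x hx => (hderiv x hx).continuousAt.continuousWithinAt
  · rw [interior_Icc]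
    exact fun x hx => (hderiv x (Set.Ioo_subset_Icc_self hx)).differentiableAt.differentiableWithinAt
  · rw [interior_Icc]
    intro x hx
    rw [(hderiv x (Set.Ioo_subset_Icc_self hx)).deriv]
    exact div_nonpos_of_nonpos_of_nonneg (neg_nonpos.mpr (hnum x (Set.Ioo_subset_Icc_self hx))) (sq_nonneg _)

/-- **(AB1)** For UPPER-SIGNED rows both letter-partial sums `A₁ = Σ_j a_{j1}/g_j` and `A₂ = Σ_j a_{j2}/g_j` are antitone on every
pole-free interval `[u,v] ⊂ (0,∞)`. [folklore; val-idea-25 AB1] -/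
theorem antitoneOn_letterSum {m : ℕ} (p q : ℕ) (a : Fin m → Fin 3 → ℝ) (hus : ∀ j, 0 ≤ a j 1 * a j 2) {u v : ℝ} (hu : 0 < u)
    (hg : ∀ x ∈ Set.Icc u v, ∀ j, a j 0 + a j 1 * x ^ p + a j 2 * x ^ q ≠ 0) :
    AntitoneOn (fun y => ∑ j, a j 1 / (a j 0 + a j 1 * y ^ p + a j 2 * y ^ q)) (Set.Icc u v) ∧
    AntitoneOn (fun y => ∑ j, a j 2 / (a j 0 + a j 1 * y ^ p + a j 2 * y ^ q)) (Set.Icc u v) := by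
  have hx0 : ∀ x ∈ Set.Icc u v, 0 < x := fun x hx => hu.trans_le hx.1
  constructor
  · intro x hx y hy hxy
    exact Finset.sum_le_sum fun j _ =>
      antitoneOn_letterTerm (a j 0) (a j 1) (a j 2) (a j 1) p q (fun z hz => hg z hz j)
        (fun z hz => (letterTerm_numerator_nonneg (a j 1) (a j 2) p q (hx0 z hz) (hus j)).1) hx hy hxy
  · intro x hx y hy hxy
    exact Finset.sum_le_sum fun j _ =>
      antitoneOn_letterTerm (a j 0) (a j 1) (a j 2) (a j 2) p q (fun z hz => hg z hz j)
        (fun z hz => (letterTerm_numerator_nonneg (a j 1) (a j 2) p q (hx0 z hz) (hus j)).2) hx hy hxy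

/-! ### AB2/AB3 — zeros of the Euler numerator on a pole-free interval -/

/-- The c-free Euler numerator at K = 3 in p7 g15's shape vanishes at a point `x > 0` off the poles iff `p x^p A₁(x) + q x^q A₂(x) = 0`.
[folklore] -/
theorem eulerNumerator_eval_eq_zero_iff {m : ℕ} (d0 p q : ℕ) (a : Fin m → Fin 3 → ℝ) {x : ℝ} (hx : 0 < x)
    (hg : ∀ j, a j 0 + a j 1 * x ^ p + a j 2 * x ^ q ≠ 0) :
    (∑ j, (∑ l, C (a j l * (((![d0, d0 + p, d0 + q] : Fin 3 → ℕ) l : ℝ) - (![d0, d0 + p, d0 + q] : Fin 3 → ℕ) 0)) *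
        X ^ ((![d0, d0 + p, d0 + q] : Fin 3 → ℕ) l)) *
      ∏ i ∈ Finset.univ.erase j, (∑ l, C (a i l) * X ^ ((![d0, d0 + p, d0 + q] : Fin 3 → ℕ) l)) : ℝ[X]).eval x = 0 ↔
    (p : ℝ) * x ^ p * (∑ j, a j 1 / (a j 0 + a j 1 * x ^ p + a j 2 * x ^ q))
        + (q : ℝ) * x ^ q * (∑ j, a j 2 / (a j 0 + a j 1 * x ^ p + a j 2 * x ^ q)) = 0 := by
  classical
  set d : Fin 3 → ℕ := ![d0, d0 + p, d0 + q] with hd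
  have hev := fun j => eval_trinomial_three d0 p q (a j) x
  have hxd : x ^ d0 ≠ 0 := pow_ne_zero _ hx.ne'
  have hF : ∀ j, a j 0 * x ^ d0 + a j 1 * x ^ (d0 + p) + a j 2 * x ^ (d0 + q) = x ^ d0 * (a j 0 + a j 1 * x ^ p + a j 2 * x ^ q) :=
    fun j => by ring
  have hf : ∀ j, (∑ l, C (a j l) * X ^ (d l) : ℝ[X]).eval x ≠ 0 := by
    intro j h
    rw [(hev j).1, hF j] at h
    exact (mul_ne_zero hxd (hg j)) h
  rw [eval_eulerNumerator_eq_prod_mul_sum d a 0 hf]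
  have hP : (∏ j, (∑ l, C (a j l) * X ^ (d l) : ℝ[X]).eval x) ≠ 0 := Finset.prod_ne_zero_iff.2 fun j _ => hf j
  rw [mul_eq_zero, or_iff_right hP]
  have hsum : (∑ j, (X * derivative (∑ l, C (a j l) * X ^ (d l) : ℝ[X]) - C ((d 0 : ℕ) : ℝ) * ∑ l, C (a j l) * X ^ (d l)).eval x
        / (∑ l, C (a j l) * X ^ (d l) : ℝ[X]).eval x)
      = ∑ j, ((p : ℝ) * a j 1 * x ^ (d0 + p) + (q : ℝ) * a j 2 * x ^ (d0 + q))
          / (a j 0 * x ^ d0 + a j 1 * x ^ (d0 + p) + a j 2 * x ^ (d0 + q)) := by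
    refine Finset.sum_congr rfl fun j _ => ?_
    rw [(hev j).1, (hev j).2]
  rw [hsum, eulerSum_eq_letterSums d0 p q a hx hg]

/-- **(AB2)** At a zero `x` of `R` inside a pole-free interval the two letter-partial sums have OPPOSITE signs, or both vanish.
[folklore; val-idea-25 AB2] -/
theorem letterSums_opposite_of_euler_zero {m : ℕ} (d0 p q : ℕ) (a : Fin m → Fin 3 → ℝ) {x : ℝ} (hx : 0 < x)
    (hg : ∀ j, a j 0 + a j 1 * x ^ p + a j 2 * x ^ q ≠ 0)
    (hR : (∑ j, (∑ l, C (a j l * (((![d0, d0 + p, d0 + q] : Fin 3 → ℕ) l : ℝ) - (![d0, d0 + p, d0 + q] : Fin 3 → ℕ) 0)) *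
        X ^ ((![d0, d0 + p, d0 + q] : Fin 3 → ℕ) l)) *
      ∏ i ∈ Finset.univ.erase j, (∑ l, C (a i l) * X ^ ((![d0, d0 + p, d0 + q] : Fin 3 → ℕ) l)) : ℝ[X]).eval x = 0)
    (hp : 0 < p) (hq : 0 < q) :
    (∑ j, a j 1 / (a j 0 + a j 1 * x ^ p + a j 2 * x ^ q)) * (∑ j, a j 2 / (a j 0 + a j 1 * x ^ p + a j 2 * x ^ q)) < 0 ∨
    ((∑ j, a j 1 / (a j 0 + a j 1 * x ^ p + a j 2 * x ^ q)) = 0 ∧ (∑ j, a j 2 / (a j 0 + a j 1 * x ^ p + a j 2 * x ^ q)) = 0) := by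
  rw [eulerNumerator_eval_eq_zero_iff d0 p q a hx hg] at hR
  set A₁ := ∑ j, a j 1 / (a j 0 + a j 1 * x ^ p + a j 2 * x ^ q)
  set A₂ := ∑ j, a j 2 / (a j 0 + a j 1 * x ^ p + a j 2 * x ^ q)
  have hpx : 0 < (p : ℝ) * x ^ p := mul_pos (by exact_mod_cast hp) (pow_pos hx _)
  have hqx : 0 < (q : ℝ) * x ^ q := mul_pos (by exact_mod_cast hq) (pow_pos hx _)
  by_cases h1 : A₁ = 0
  · right
    refine ⟨h1, ?_⟩
    rw [h1, mul_zero, zero_add] at hR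
    exact (mul_eq_zero.mp hR).resolve_left hqx.ne'
  · left
    -- `A₂ = −(p x^p/(q x^q))·A₁`
    have hA₂ : A₂ = -((p : ℝ) * x ^ p / ((q : ℝ) * x ^ q)) * A₁ := by
      field_simp
      linarith
    rw [hA₂]
    have : A₁ * (-((p : ℝ) * x ^ p / ((q : ℝ) * x ^ q)) * A₁) = -((p : ℝ) * x ^ p / ((q : ℝ) * x ^ q)) * (A₁ * A₁) := by ring
    rw [this]
    exact mul_neg_of_neg_of_pos (neg_neg_of_pos (div_pos hpx hqx)) (mul_self_pos.mpr h1)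

/-- ★ **(AB3, letter-1 sum positive)** UPPER-SIGNED company, `0 < p < q`, pole-free interval `[u,v] ⊂ (0,∞)` on which the letter-1 partial
sum `A₁ = Σ_j a_{j1}/g_j` is POSITIVE: the c-free Euler numerator has AT MOST ONE zero in `[u,v]` (`p x^{−(q−p)} A₁ + q A₂` is strictly
antitone). [this file's theorem; val-idea-25 AB3] -/
theorem eulerNumerator_roots_Icc_le_one_of_letterSum_one_pos {m : ℕ} (d0 p q : ℕ) (hp : 0 < p) (hpq : p < q)
    (a : Fin m → Fin 3 → ℝ) (hus : ∀ j, 0 ≤ a j 1 * a j 2) {u v : ℝ} (hu : 0 < u)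
    (hg : ∀ x ∈ Set.Icc u v, ∀ j, a j 0 + a j 1 * x ^ p + a j 2 * x ^ q ≠ 0)
    (hA : ∀ x ∈ Set.Icc u v, 0 < ∑ j, a j 1 / (a j 0 + a j 1 * x ^ p + a j 2 * x ^ q)) :
    ((∑ j, (∑ l, C (a j l * (((![d0, d0 + p, d0 + q] : Fin 3 → ℕ) l : ℝ) - (![d0, d0 + p, d0 + q] : Fin 3 → ℕ) 0)) *
        X ^ ((![d0, d0 + p, d0 + q] : Fin 3 → ℕ) l)) *
      ∏ i ∈ Finset.univ.erase j, (∑ l, C (a i l) * X ^ ((![d0, d0 + p, d0 + q] : Fin 3 → ℕ) l)) : ℝ[X]).roots.toFinset.filter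
        (fun t => u ≤ t ∧ t ≤ v)).card ≤ 1 := by
  classical
  set A₁ : ℝ → ℝ := fun y => ∑ j, a j 1 / (a j 0 + a j 1 * y ^ p + a j 2 * y ^ q) with hA₁
  set A₂ : ℝ → ℝ := fun y => ∑ j, a j 2 / (a j 0 + a j 1 * y ^ p + a j 2 * y ^ q) with hA₂
  obtain ⟨hA₁anti, hA₂anti⟩ := antitoneOn_letterSum p q a hus hu hg
  -- the normalised function `Ξ(x) = p x^{−(q−p)} A₁(x) + q A₂(x)` is strictly antitone on `[u,v]`
  have hΞ : ∀ x ∈ Set.Icc u v, ∀ y ∈ Set.Icc u v, x < y →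
      (p : ℝ) * (y ^ (q - p))⁻¹ * A₁ y + (q : ℝ) * A₂ y < (p : ℝ) * (x ^ (q - p))⁻¹ * A₁ x + (q : ℝ) * A₂ x := by
    intro x hx y hy hxy
    have hx0 : 0 < x := hu.trans_le hx.1
    have h1 : A₁ y ≤ A₁ x := hA₁anti hx hy hxy.le
    have h2 : A₂ y ≤ A₂ x := hA₂anti hx hy hxy.le
    have hpow : x ^ (q - p) < y ^ (q - p) := pow_lt_pow_left₀ hxy hx0.le (by omega)
    have hxp : 0 < x ^ (q - p) := pow_pos hx0 _
    have hinv : (y ^ (q - p))⁻¹ < (x ^ (q - p))⁻¹ := inv_strictAnti₀ hxp hpow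
    have hAy : 0 < A₁ y := hA y hy
    have hpR : 0 < (p : ℝ) := by exact_mod_cast hp
    have hqR : 0 ≤ (q : ℝ) := Nat.cast_nonneg _
    have step1 : (p : ℝ) * (y ^ (q - p))⁻¹ * A₁ y < (p : ℝ) * (x ^ (q - p))⁻¹ * A₁ y := by
      have := mul_lt_mul_of_pos_right hinv hAy
      nlinarith
    have step2 : (p : ℝ) * (x ^ (q - p))⁻¹ * A₁ y ≤ (p : ℝ) * (x ^ (q - p))⁻¹ * A₁ x :=
      mul_le_mul_of_nonneg_left h1 (mul_nonneg hpR.le (inv_nonneg.mpr hxp.le))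
    have step3 : (q : ℝ) * A₂ y ≤ (q : ℝ) * A₂ x := mul_le_mul_of_nonneg_left h2 hqR
    linarith
  -- every root in `[u,v]` is a zero of `Ξ`
  have hroot : ∀ t, t ∈ ((∑ j, (∑ l, C (a j l * (((![d0, d0 + p, d0 + q] : Fin 3 → ℕ) l : ℝ) - (![d0, d0 + p, d0 + q] : Fin 3 → ℕ) 0)) *
        X ^ ((![d0, d0 + p, d0 + q] : Fin 3 → ℕ) l)) *
      ∏ i ∈ Finset.univ.erase j, (∑ l, C (a i l) * X ^ ((![d0, d0 + p, d0 + q] : Fin 3 → ℕ) l)) : ℝ[X]).roots.toFinset.filter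
        (fun t => u ≤ t ∧ t ≤ v)) → (p : ℝ) * (t ^ (q - p))⁻¹ * A₁ t + (q : ℝ) * A₂ t = 0 := by
    intro t ht
    rw [Finset.mem_filter, Multiset.mem_toFinset] at ht
    obtain ⟨hrt, htI⟩ := ht
    have htI' : t ∈ Set.Icc u v := htI
    have ht0 : 0 < t := hu.trans_le htI.1
    have hev : _ := (mem_roots (ne_zero_of_mem_roots hrt |> fun h => by exact h)).mp hrt
    have hz := (eulerNumerator_eval_eq_zero_iff d0 p q a ht0 (hg t htI')).mp hev
    -- divide by `t^q > 0`
    have htq : (t ^ q) ≠ 0 := pow_ne_zero _ ht0.ne'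
    have hsplit : t ^ q = t ^ (q - p) * t ^ p := by rw [← pow_add, Nat.sub_add_cancel hpq.le]
    have : (p : ℝ) * (t ^ (q - p))⁻¹ * A₁ t + (q : ℝ) * A₂ t
        = ((p : ℝ) * t ^ p * A₁ t + (q : ℝ) * t ^ q * A₂ t) / t ^ q := by
      rw [hsplit]
      field_simp
    rw [this, hz, zero_div]
  rw [Finset.card_le_one]
  intro t₁ ht₁ t₂ ht₂
  have h1 := hroot t₁ ht₁
  have h2 := hroot t₂ ht₂
  have ht₁I : t₁ ∈ Set.Icc u v := (Finset.mem_filter.mp ht₁).2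
  have ht₂I : t₂ ∈ Set.Icc u v := (Finset.mem_filter.mp ht₂).2
  by_contra hne
  rcases lt_or_gt_of_ne hne with h | h
  · have := hΞ t₁ ht₁I t₂ ht₂I h; linarith
  · have := hΞ t₂ ht₂I t₁ ht₁I h; linarith

/-- ★ **(AB3, letter-2 sum negative)** UPPER-SIGNED company, `0 < p < q`, pole-free interval `[u,v] ⊂ (0,∞)` on which the letter-2 partial
sum `A₂ = Σ_j a_{j2}/g_j` is NEGATIVE: the c-free Euler numerator has AT MOST ONE zero in `[u,v]` (`p A₁ + q x^{q−p} A₂` is strictly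
antitone) — val-idea-25's «type β» windows. [this file's theorem; val-idea-25 AB3] -/
theorem eulerNumerator_roots_Icc_le_one_of_letterSum_two_neg {m : ℕ} (d0 p q : ℕ) (hp : 0 < p) (hpq : p < q)
    (a : Fin m → Fin 3 → ℝ) (hus : ∀ j, 0 ≤ a j 1 * a j 2) {u v : ℝ} (hu : 0 < u)
    (hg : ∀ x ∈ Set.Icc u v, ∀ j, a j 0 + a j 1 * x ^ p + a j 2 * x ^ q ≠ 0)
    (hA : ∀ x ∈ Set.Icc u v, ∑ j, a j 2 / (a j 0 + a j 1 * x ^ p + a j 2 * x ^ q) < 0) :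
    ((∑ j, (∑ l, C (a j l * (((![d0, d0 + p, d0 + q] : Fin 3 → ℕ) l : ℝ) - (![d0, d0 + p, d0 + q] : Fin 3 → ℕ) 0)) *
        X ^ ((![d0, d0 + p, d0 + q] : Fin 3 → ℕ) l)) *
      ∏ i ∈ Finset.univ.erase j, (∑ l, C (a i l) * X ^ ((![d0, d0 + p, d0 + q] : Fin 3 → ℕ) l)) : ℝ[X]).roots.toFinset.filter
        (fun t => u ≤ t ∧ t ≤ v)).card ≤ 1 := by
  classical
  set A₁ : ℝ → ℝ := fun y => ∑ j, a j 1 / (a j 0 + a j 1 * y ^ p + a j 2 * y ^ q) with hA₁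
  set A₂ : ℝ → ℝ := fun y => ∑ j, a j 2 / (a j 0 + a j 1 * y ^ p + a j 2 * y ^ q) with hA₂
  obtain ⟨hA₁anti, hA₂anti⟩ := antitoneOn_letterSum p q a hus hu hg
  -- `Ξ(x) = p A₁(x) + q x^{q−p} A₂(x)` is strictly antitone on `[u,v]`
  have hΞ : ∀ x ∈ Set.Icc u v, ∀ y ∈ Set.Icc u v, x < y →
      (p : ℝ) * A₁ y + (q : ℝ) * y ^ (q - p) * A₂ y < (p : ℝ) * A₁ x + (q : ℝ) * x ^ (q - p) * A₂ x := by
    intro x hx y hy hxy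
    have hx0 : 0 < x := hu.trans_le hx.1
    have h1 : A₁ y ≤ A₁ x := hA₁anti hx hy hxy.le
    have h2 : A₂ y ≤ A₂ x := hA₂anti hx hy hxy.le
    have hpow : x ^ (q - p) < y ^ (q - p) := pow_lt_pow_left₀ hxy hx0.le (by omega)
    have hxp : 0 < x ^ (q - p) := pow_pos hx0 _
    have hAx : A₂ x < 0 := hA x hx
    have hAy : A₂ y < 0 := hA y hy
    have hpR : 0 ≤ (p : ℝ) := Nat.cast_nonneg _
    have hqR : 0 < (q : ℝ) := by exact_mod_cast (hp.trans hpq)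
    have step1 : (q : ℝ) * y ^ (q - p) * A₂ y ≤ (q : ℝ) * y ^ (q - p) * A₂ x :=
      mul_le_mul_of_nonneg_left h2 (mul_nonneg hqR.le (pow_nonneg (hx0.trans hxy).le _))
    have step2 : (q : ℝ) * y ^ (q - p) * A₂ x < (q : ℝ) * x ^ (q - p) * A₂ x := by
      have := mul_lt_mul_of_neg_right hpow hAx
      nlinarith
    have step3 : (p : ℝ) * A₁ y ≤ (p : ℝ) * A₁ x := mul_le_mul_of_nonneg_left h1 hpR
    linarith
  have hroot : ∀ t, t ∈ ((∑ j, (∑ l, C (a j l * (((![d0, d0 + p, d0 + q] : Fin 3 → ℕ) l : ℝ) - (![d0, d0 + p, d0 + q] : Fin 3 → ℕ) 0)) *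
        X ^ ((![d0, d0 + p, d0 + q] : Fin 3 → ℕ) l)) *
      ∏ i ∈ Finset.univ.erase j, (∑ l, C (a i l) * X ^ ((![d0, d0 + p, d0 + q] : Fin 3 → ℕ) l)) : ℝ[X]).roots.toFinset.filter
        (fun t => u ≤ t ∧ t ≤ v)) → (p : ℝ) * A₁ t + (q : ℝ) * t ^ (q - p) * A₂ t = 0 := by
    intro t ht
    rw [Finset.mem_filter, Multiset.mem_toFinset] at ht
    obtain ⟨hrt, htI⟩ := ht
    have htI' : t ∈ Set.Icc u v := htI
    have ht0 : 0 < t := hu.trans_le htI.1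
    have hev : _ := (mem_roots (ne_zero_of_mem_roots hrt |> fun h => by exact h)).mp hrt
    have hz := (eulerNumerator_eval_eq_zero_iff d0 p q a ht0 (hg t htI')).mp hev
    have htp : (t ^ p) ≠ 0 := pow_ne_zero _ ht0.ne'
    have hsplit : t ^ q = t ^ p * t ^ (q - p) := by rw [← pow_add, Nat.add_sub_cancel' hpq.le]
    have : (p : ℝ) * A₁ t + (q : ℝ) * t ^ (q - p) * A₂ t
        = ((p : ℝ) * t ^ p * A₁ t + (q : ℝ) * t ^ q * A₂ t) / t ^ p := by
      rw [hsplit]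
      field_simp
    rw [this, hz, zero_div]
  rw [Finset.card_le_one]
  intro t₁ ht₁ t₂ ht₂
  have h1 := hroot t₁ ht₁
  have h2 := hroot t₂ ht₂
  have ht₁I : t₁ ∈ Set.Icc u v := (Finset.mem_filter.mp ht₁).2
  have ht₂I : t₂ ∈ Set.Icc u v := (Finset.mem_filter.mp ht₂).2
  by_contra hne
  rcases lt_or_gt_of_ne hne with h | h
  · have := hΞ t₁ ht₁I t₂ ht₂I h; linarith
  · have := hΞ t₂ ht₂I t₁ ht₁I h; linarith

end ProductPlusOne

end Summit.ValiantsHypothesis.ValiantsHypothesis.Theorems.LacunarySymmetroidMatrixDescartes
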